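import Literature.Probability.RandomPlanarGeometry.CurveSpace
import Mathlib.Topology.MetricSpace.Thickening
import HarnessLib

/-!
# Near-tracing events are closed and shrink to the tracing event: stub
`stub_kernel_nearTrace_closed` (K9a) of line `hitting-tournament` for crux `LagHandOff`
(stmt-CriticalPhenomena-10268)

Soft half of the boundary kernel (KERNEL-c5 §2).  For a closed set `F ⊆ ℂ`, a length `η > 0`
and a radius `ε`, the *near-tracing event* `NT_ε(η, F)` is the set of curve classes
`γ : CurveClass ℂ` having a representative `c` with a sub-arc `c[s, t]` (`s < t`) of diameter
`≥ η` inside the closed `ε`-neighbourhood `Metric.cthickening ε F`.  We prove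

* `NT_ε(η, F)` is closed in `CurveClass ℂ` for every `ε ≥ 0` (needed for portmanteau), and
* `⋂_{ε > 0} NT_ε(η, F) ⊆ NT_0(η, F)` (sub-arc inside `F` itself).

Proof.  Both statements reduce to one compactness lemma about a SINGLE curve `c`
(`KernelNearTraceClosed.exists_subarc_of_approx`): if sub-arcs `c[aₙ, bₙ]` (`aₙ ≤ bₙ`) satisfy
`η ≤ diam c[aₙ, bₙ] + 2 rₙ` and `c[aₙ, bₙ] ⊆ cthickening rₙ K` with `rₙ → 0` and `K` closed,
then some sub-arc `c[s, t]`, `s < t`, has diameter `≥ η` and lies in `K`.  Indeed, choose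
near-diametral pairs `uₙ, vₙ ∈ [aₙ, bₙ]`, pass to a subsequence along which
`(aₙ, bₙ, uₙ, vₙ) → (s, t, u, v)` (compactness of `I⁴`); then `u, v ∈ [s, t]`,
`dist (c u) (c v) ≥ η` by continuity, and every `ρ ∈ [s, t]` is the limit of the clamped
parameters `max aₙ (min bₙ ρ) ∈ [aₙ, bₙ]`, whose images lie in `cthickening rₙ K`, so that
`c ρ ∈ ⋂_{δ > 0} cthickening δ K = closure K = K`; finally `s < t` because `s = t` forces
`u = v` and `0 ≥ η`.

The reduction uses the reparametrisation distance (Aizenman–Burchard 1999, §2.1): if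
`dist c' c < r` there is an increasing homeomorphism `φ` of `I` with
`dist (c' u) (c (φ u)) ≤ r` for all `u` (`Curve.exists_dist_reparam_lt`), and then the sub-arc
`c'[s, t]` is carried to `c[φ s, φ t]` up to `r`: `c[φ s, φ t] ⊆ cthickening r K` whenever
`c'[s, t] ⊆ K`, and `diam c'[s, t] ≤ diam c[φ s, φ t] + 2 r`
(`image_Icc_subset_cthickening_of_reparam`, `diam_image_Icc_le_of_reparam`).

* Closedness: if `γₙ → γ = mk c` with `γₙ = mk cₙ ∈ NT_ε`, then `dist cₙ c → 0`; transport
  the witnessing sub-arcs of `cₙ` to `c` with `rₙ = dist cₙ c + 1/(n+1)` and apply the lemma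
  with `K = cthickening ε F`.
* Intersection: if `mk c ∈ NT_{1/(n+1)}` for all `n`, the witnesses `cₙ` satisfy
  `dist cₙ c = 0 < 1/(n+1)`; transport to `c` (landing in
  `cthickening (1/(n+1)) (cthickening (1/(n+1)) F) ⊆ cthickening (2/(n+1)) F`) and apply the
  lemma with `K = F`.

Helpers live in the sub-namespace `KernelNearTraceClosed`.
-/

noncomputable section

open Set Metric Filter Topology
open scoped unitInterval
open Literature.Probability.RandomPlanarGeometry

namespace Summit.CriticalPhenomena.CardyFormulaZ2.Cruxes.LagHandOff.HittingTournament

namespace KernelNearTraceClosed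

variable {X : Type*} [PseudoMetricSpace X]

/-- Clamping a parameter into a nonempty parameter interval `[a, b]`. -/
theorem clamp_mem_Icc {a b : I} (hab : a ≤ b) (u : I) : max a (min b u) ∈ Icc a b :=
  ⟨le_max_left _ _, max_le hab (min_le_left _ _)⟩

/-- Sub-arcs of a curve are bounded (continuous images of a compact interval). -/
theorem isBounded_image_Icc (c : Curve X) (a b : I) : Bornology.IsBounded (c '' Icc a b) :=
  (isCompact_Icc.image c.continuous).isBounded

/-- **Pointwise form of the reparametrisation distance.** If `dist c' c < r` then, for some
increasing homeomorphism `φ` of the parameter interval, `dist (c' u) (c (φ u)) ≤ r` for all `u`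
(Aizenman–Burchard 1999, §2.1, eq. (2.2)). -/
theorem exists_reparam_forall_dist_le {c' c : Curve X} {r : ℝ} (h : dist c' c < r) :
    ∃ φ : I ≃o I, ∀ u, dist (c' u) (c (φ u)) ≤ r := by
  obtain ⟨φ, hφ⟩ := Curve.exists_dist_reparam_lt h
  refine ⟨φ, fun u ↦ ?_⟩
  have h1 := ContinuousMap.dist_apply_le_dist (f := c'.toContinuousMap)
    (g := (c.reparam φ).toContinuousMap) (x := u)
  simp only [Curve.coe_toContinuousMap, Curve.reparam_apply] at h1
  exact h1.trans hφ.le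

/-- **Transport of a sub-arc along a reparametrisation, inclusion.** If `dist (c' u) (c (φ u)) ≤ r`
for all `u` and `c'[s, t] ⊆ K`, then `c[φ s, φ t] ⊆ cthickening r K`. -/
theorem image_Icc_subset_cthickening_of_reparam {c' c : Curve X} {φ : I ≃o I} {r : ℝ}
    (h : ∀ u, dist (c' u) (c (φ u)) ≤ r) {K : Set X} {s t : I} (hK : c' '' Icc s t ⊆ K) :
    c '' Icc (φ s) (φ t) ⊆ cthickening r K := by
  rintro _ ⟨w, hw, rfl⟩
  have hv : φ.symm w ∈ Icc s t := by
    constructor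
    · simpa using φ.symm.monotone hw.1
    · simpa using φ.symm.monotone hw.2
  refine mem_cthickening_of_dist_le _ (c' (φ.symm w)) _ _ (hK ⟨_, hv, rfl⟩) ?_
  rw [dist_comm]
  simpa using h (φ.symm w)

/-- **Transport of a sub-arc along a reparametrisation, diameter.** If `dist (c' u) (c (φ u)) ≤ r`
for all `u` (`r ≥ 0`), then `diam c'[s, t] ≤ diam c[φ s, φ t] + 2 r`. -/
theorem diam_image_Icc_le_of_reparam {c' c : Curve X} {φ : I ≃o I} {r : ℝ} (hr : 0 ≤ r)
    (h : ∀ u, dist (c' u) (c (φ u)) ≤ r) (s t : I) :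
    diam (c' '' Icc s t) ≤ diam (c '' Icc (φ s) (φ t)) + 2 * r := by
  refine diam_le_of_forall_dist_le (by positivity) ?_
  rintro _ ⟨v, hv, rfl⟩ _ ⟨v', hv', rfl⟩
  have hφv : φ v ∈ Icc (φ s) (φ t) := ⟨φ.monotone hv.1, φ.monotone hv.2⟩
  have hφv' : φ v' ∈ Icc (φ s) (φ t) := ⟨φ.monotone hv'.1, φ.monotone hv'.2⟩
  calc dist (c' v) (c' v')
      ≤ dist (c' v) (c (φ v)) + dist (c (φ v)) (c (φ v')) + dist (c (φ v')) (c' v') :=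
        dist_triangle4 _ _ _ _
    _ ≤ r + diam (c '' Icc (φ s) (φ t)) + r := by
        gcongr
        · exact h v
        · exact dist_le_diam_of_mem (isBounded_image_Icc c _ _) ⟨_, hφv, rfl⟩ ⟨_, hφv', rfl⟩
        · rw [dist_comm]; exact h v'
    _ = diam (c '' Icc (φ s) (φ t)) + 2 * r := by ring

/-- **Limits of sub-arcs of one curve.** Let `c` be a curve, `K` a closed set, `η > 0`, and
let `c[aₙ, bₙ]` (`aₙ ≤ bₙ`) be sub-arcs with `η ≤ diam c[aₙ, bₙ] + 2 rₙ` and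
`c[aₙ, bₙ] ⊆ cthickening rₙ K`, where `rₙ → 0`.  Then some sub-arc `c[s, t]` with `s < t` has
diameter `≥ η` and lies in `K`.  (Compactness of `I⁴`: subsequential limit of the endpoints and
of a near-diametral pair; the inclusion by clamping parameters into `[aₙ, bₙ]` and
`closure K = ⋂_{δ>0} cthickening δ K`.) -/
theorem exists_subarc_of_approx (c : Curve X) {K : Set X} (hK : IsClosed K) {η : ℝ}
    (hη : 0 < η) {a b : ℕ → I} {r : ℕ → ℝ} (hr : Tendsto r atTop (𝓝 0))
    (hab : ∀ n, a n ≤ b n) (hdiam : ∀ n, η ≤ diam (c '' Icc (a n) (b n)) + 2 * r n)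
    (hsub : ∀ n, c '' Icc (a n) (b n) ⊆ cthickening (r n) K) :
    ∃ s t : I, s < t ∧ η ≤ diam (c '' Icc s t) ∧ c '' Icc s t ⊆ K := by
  -- near-diametral pairs of parameters
  have hpair : ∀ n, ∃ p : I × I, p.1 ∈ Icc (a n) (b n) ∧ p.2 ∈ Icc (a n) (b n) ∧
      η - 2 * r n - 1 / ((n : ℝ) + 1) < dist (c p.1) (c p.2) := by
    intro n
    by_contra hcon
    push Not at hcon
    have h1 : diam (c '' Icc (a n) (b n)) ≤ η - 2 * r n - 1 / ((n : ℝ) + 1) :=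
      diam_le_of_forall_dist_le_of_nonempty ((nonempty_Icc.2 (hab n)).image c) (by
        rintro _ ⟨u, hu, rfl⟩ _ ⟨v, hv, rfl⟩
        exact hcon (u, v) hu hv)
    have h2 : (0 : ℝ) < 1 / ((n : ℝ) + 1) := by positivity
    linarith [hdiam n]
  choose p hp1 hp2 hpd using hpair
  -- a subsequence along which endpoints and near-diametral pairs converge
  obtain ⟨⟨⟨s, t⟩, ⟨u, v⟩⟩, θ, hθ, hlim⟩ :=
    CompactSpace.tendsto_subseq fun n ↦ ((a n, b n), p n)
  have ha : Tendsto (fun k ↦ a (θ k)) atTop (𝓝 s) := hlim.fst_nhds.fst_nhds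
  have hb : Tendsto (fun k ↦ b (θ k)) atTop (𝓝 t) := hlim.fst_nhds.snd_nhds
  have hu : Tendsto (fun k ↦ (p (θ k)).1) atTop (𝓝 u) := hlim.snd_nhds.fst_nhds
  have hv : Tendsto (fun k ↦ (p (θ k)).2) atTop (𝓝 v) := hlim.snd_nhds.snd_nhds
  have hrθ : Tendsto (fun k ↦ r (θ k)) atTop (𝓝 0) := hr.comp hθ.tendsto_atTop
  have hus : u ∈ Icc s t :=
    ⟨le_of_tendsto_of_tendsto' ha hu fun k ↦ (hp1 (θ k)).1,
      le_of_tendsto_of_tendsto' hu hb fun k ↦ (hp1 (θ k)).2⟩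
  have hvs : v ∈ Icc s t :=
    ⟨le_of_tendsto_of_tendsto' ha hv fun k ↦ (hp2 (θ k)).1,
      le_of_tendsto_of_tendsto' hv hb fun k ↦ (hp2 (θ k)).2⟩
  have hst : s ≤ t := hus.1.trans hus.2
  -- the limit pair is at distance `≥ η`
  have hdist : η ≤ dist (c u) (c v) := by
    have h1 : Tendsto (fun k ↦ dist (c (p (θ k)).1) (c (p (θ k)).2)) atTop
        (𝓝 (dist (c u) (c v))) :=
      ((c.continuous.tendsto u).comp hu).dist ((c.continuous.tendsto v).comp hv)
    have h2 : Tendsto (fun k ↦ η - 2 * r (θ k) - 1 / ((θ k : ℝ) + 1)) atTop (𝓝 η) := by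
      have h3 : Tendsto (fun k ↦ 1 / ((θ k : ℝ) + 1)) atTop (𝓝 0) :=
        (tendsto_one_div_add_atTop_nhds_zero_nat (𝕜 := ℝ)).comp hθ.tendsto_atTop
      have h4 := ((tendsto_const_nhds (x := η)).sub (hrθ.const_mul 2)).sub h3
      simpa using h4
    exact le_of_tendsto_of_tendsto' h2 h1 fun k ↦ (hpd (θ k)).le
  -- every point of the limit sub-arc lies in `K`
  have hincl : c '' Icc s t ⊆ K := by
    rintro _ ⟨ρ, hρ, rfl⟩
    have hq : ∀ k, max (a (θ k)) (min (b (θ k)) ρ) ∈ Icc (a (θ k)) (b (θ k)) :=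
      fun k ↦ clamp_mem_Icc (hab _) ρ
    have hqlim : Tendsto (fun k ↦ max (a (θ k)) (min (b (θ k)) ρ)) atTop (𝓝 ρ) := by
      have h1 := ha.max (hb.min (tendsto_const_nhds (x := ρ)))
      rwa [min_eq_right hρ.2, max_eq_right hρ.1] at h1
    have hcq : Tendsto (fun k ↦ c (max (a (θ k)) (min (b (θ k)) ρ))) atTop (𝓝 (c ρ)) :=
      (c.continuous.tendsto ρ).comp hqlim
    refine hK.closure_subset ?_
    rw [closure_eq_iInter_cthickening]
    refine mem_iInter₂.2 fun δ hδ ↦ isClosed_cthickening.mem_of_tendsto hcq ?_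
    filter_upwards [(tendsto_order.1 hrθ).2 δ hδ] with k hk
    exact cthickening_mono hk.le K (hsub (θ k) ⟨_, hq k, rfl⟩)
  refine ⟨s, t, lt_of_le_of_ne hst ?_, hdist.trans (dist_le_diam_of_mem
    (isBounded_image_Icc c s t) ⟨u, hus, rfl⟩ ⟨v, hvs, rfl⟩), hincl⟩
  rintro rfl
  have huv : u = v := le_antisymm (hus.2.trans hvs.1) (hvs.2.trans hus.1)
  rw [huv, dist_self] at hdist
  exact absurd hdist (not_le.2 hη)

end KernelNearTraceClosed

open KernelNearTraceClosed in
/-- **K9a `stub_kernel_nearTrace_closed`.** For a closed set `F ⊆ ℂ` and `η > 0`: (i) for every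
`ε ≥ 0` the near-tracing event `NT_ε(η, F)` — curve classes having a representative with a
sub-arc `c[s, t]`, `s < t`, of diameter `≥ η` inside `Metric.cthickening ε F` — is closed in
`CurveClass ℂ`; (ii) `⋂_{ε > 0} NT_ε(η, F)` is contained in the tracing event `NT_0(η, F)`
(sub-arc inside `F`).  Both follow from `KernelNearTraceClosed.exists_subarc_of_approx` after
transporting the witnessing sub-arcs to a fixed representative of the limit class along
almost-optimal reparametrisations. -/
theorem stub_kernel_nearTrace_closed :
    ∀ (F : Set ℂ), IsClosed F → ∀ (η : ℝ), 0 < η →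
      (∀ ε : ℝ, 0 ≤ ε → IsClosed {γ : CurveClass ℂ | ∃ c : Curve ℂ, CurveClass.mk c = γ ∧
        ∃ s t : unitInterval, s < t ∧ η ≤ Metric.diam (c '' Set.Icc s t) ∧
          c '' Set.Icc s t ⊆ Metric.cthickening ε F}) ∧
      (⋂ (ε : ℝ) (_ : 0 < ε), {γ : CurveClass ℂ | ∃ c : Curve ℂ, CurveClass.mk c = γ ∧
        ∃ s t : unitInterval, s < t ∧ η ≤ Metric.diam (c '' Set.Icc s t) ∧
          c '' Set.Icc s t ⊆ Metric.cthickening ε F}) ⊆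
      {γ : CurveClass ℂ | ∃ c : Curve ℂ, CurveClass.mk c = γ ∧
        ∃ s t : unitInterval, s < t ∧ η ≤ Metric.diam (c '' Set.Icc s t) ∧
          c '' Set.Icc s t ⊆ F} := by
  intro F hF η hη
  refine ⟨fun ε _ ↦ ?_, fun γ hγ ↦ ?_⟩
  · -- (i) sequential closedness
    refine IsSeqClosed.isClosed fun x γ hx hxγ ↦ ?_
    choose cn hcn sn tn hst hdiam hsub using hx
    obtain ⟨c, rfl⟩ := CurveClass.surjective_mk γ
    have hd : Tendsto (fun n ↦ dist (cn n) c) atTop (𝓝 0) := by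
      refine (tendsto_iff_dist_tendsto_zero.1 hxγ).congr fun n ↦ ?_
      rw [← hcn n, CurveClass.dist_mk_mk]
    have hr : Tendsto (fun n ↦ dist (cn n) c + 1 / ((n : ℝ) + 1)) atTop (𝓝 0) := by
      simpa using hd.add (tendsto_one_div_add_atTop_nhds_zero_nat (𝕜 := ℝ))
    have hrpos : ∀ n, 0 ≤ dist (cn n) c + 1 / ((n : ℝ) + 1) := fun n ↦ by positivity
    have hφ : ∀ n, ∃ φ : I ≃o I, ∀ u, dist (cn n u) (c (φ u)) ≤ dist (cn n) c + 1 / ((n : ℝ) + 1) :=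
      fun n ↦ exists_reparam_forall_dist_le (lt_add_of_pos_right _ (by positivity))
    choose φ hφ using hφ
    obtain ⟨s, t, hst', hd', hsub'⟩ := exists_subarc_of_approx c isClosed_cthickening hη
      (a := fun n ↦ φ n (sn n)) (b := fun n ↦ φ n (tn n)) hr
      (fun n ↦ (φ n).monotone (hst n).le)
      (fun n ↦ (hdiam n).trans (diam_image_Icc_le_of_reparam (hrpos n) (hφ n) _ _))
      (fun n ↦ image_Icc_subset_cthickening_of_reparam (hφ n) (hsub n))
    exact ⟨c, rfl, s, t, hst', hd', hsub'⟩
  · -- (ii) the intersection over `ε > 0`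
    obtain ⟨c, rfl⟩ := CurveClass.surjective_mk γ
    have hmem : ∀ n : ℕ, ∃ q : I × I, q.1 ≤ q.2 ∧
        η ≤ diam (c '' Icc q.1 q.2) + 2 * (2 * (1 / ((n : ℝ) + 1))) ∧
        c '' Icc q.1 q.2 ⊆ cthickening (2 * (1 / ((n : ℝ) + 1))) F := by
      intro n
      have hn : (0 : ℝ) < 1 / ((n : ℝ) + 1) := by positivity
      obtain ⟨c', hc', s, t, hst, hdiam, hsub⟩ := mem_iInter₂.1 hγ (1 / ((n : ℝ) + 1)) hn
      have h0 : dist c' c < 1 / ((n : ℝ) + 1) := by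
        rw [CurveClass.mk_eq_mk_iff_dist_eq_zero.1 hc']
        exact hn
      obtain ⟨φ, hφ⟩ := exists_reparam_forall_dist_le h0
      refine ⟨(φ s, φ t), φ.monotone hst.le, ?_, ?_⟩
      · have h1 := diam_image_Icc_le_of_reparam hn.le hφ s t
        linarith
      · rw [two_mul]
        exact (image_Icc_subset_cthickening_of_reparam hφ hsub).trans
          (cthickening_cthickening_subset hn.le hn.le F)
    choose q hq hdiam hsub using hmem
    have hr : Tendsto (fun n : ℕ ↦ 2 * (1 / ((n : ℝ) + 1))) atTop (𝓝 0) := by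
      simpa using (tendsto_one_div_add_atTop_nhds_zero_nat (𝕜 := ℝ)).const_mul 2
    obtain ⟨s, t, hst, hd, hsub'⟩ := exists_subarc_of_approx c hF hη
      (a := fun n ↦ (q n).1) (b := fun n ↦ (q n).2) hr hq hdiam hsub
    exact ⟨c, rfl, s, t, hst, hd, hsub'⟩

end Summit.CriticalPhenomena.CardyFormulaZ2.Cruxes.LagHandOff.HittingTournament

end
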